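import Literature.Analysis.OperatorTheory.PseudospectralEnclosureNet
import HarnessLib

/-!
# Bounded invertibility under a bounded (e.g. finite-rank) perturbation — the Woodbury step

Topic `Literature/Analysis/OperatorTheory`; proofs-layer file (theorems only), frame of `InverseNormSpectrumLowerBound.lean`
(`HasBoundedInverse p T B`: `B : E →L E` is a two-sided bounded inverse of the linear map `T : p → E` on a submodule `p`).

If `T` has the bounded inverse `B` and `F : E →L E` is bounded, then `T − F|ₚ = (1 − F B) ∘ T` on `p`, so `T − F|ₚ` has the
bounded inverse `B (1 − F B)⁻¹` as soon as `W := 1 − F B` is invertible in `E →L E`: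

* `HasBoundedInverse.sub_of_unit` — the identity above for an arbitrary unit `W` with `↑W = 1 − F ∘ B` (this is the form used
  when `F` has finite rank and `W⁻¹` is certified through the capacitance matrix — Sherman–Morrison–Woodbury)
  [cite: Kato1966, IV-§1.4, Thm. 1.16];
* `HasBoundedInverse.sub_of_norm_lt`, `HasBoundedInverse.exists_sub_norm_le` — the small-norm case `‖F ∘ B‖ < 1`
  (Neumann series) with the bound `‖B (1 − F B)⁻¹‖ ≤ ‖B‖ / (1 − ‖F ∘ B‖)` [cite: Kato1966, IV-§1.4, Thm. 1.16];
* `resolventShift_sub` — bookkeeping: `(L − z) − F|ₚ = (L − F|ₚ) − z`, so the lemmas apply to resolvent shifts of a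
  perturbed operator `L = G − F|ₚ` (e.g. `G = L + ηP` coercive, `F = ηP` of finite rank).

Why it is here: step "E5" of an energy/finite-rank resolvent certificate — a coercive auxiliary operator `G_z = L − z + ηP`
is inverted with a norm bound (`exists_hasBoundedInverse_norm_le_of_coercive`), and `L − z = G_z − ηP|ₚ` is then inverted
through the finite-rank factor `1 − ηP G_z⁻¹`. Everything is proved; nothing about a particular operator is asserted.

## References

* T. Kato, *Perturbation Theory for Linear Operators*, Springer 1966/1976, IV-§1.4 (Thm. 1.16), IV-§3.1. [Kato1966]
* W. W. Hager, *Updating the inverse of a matrix*, SIAM Rev. 31 (1989) 221–239 (Sherman–Morrison–Woodbury). [Hager1989]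
-/

noncomputable section

namespace Literature.Analysis.OperatorTheory

variable {𝕜 E : Type*} [NontriviallyNormedField 𝕜] [NormedAddCommGroup E] [NormedSpace 𝕜 E]

/-- Bookkeeping: `(L − z) − F|ₚ = (L − F|ₚ) − z` as linear maps `p → E`. [folklore] -/
theorem resolventShift_sub (p : Submodule 𝕜 E) (L : p →ₗ[𝕜] E) (F : E →L[𝕜] E) (z : 𝕜) :
    resolventShift p L z - (F : E →ₗ[𝕜] E).comp p.subtype =
      resolventShift p (L - (F : E →ₗ[𝕜] E).comp p.subtype) z := by
  simp only [resolventShift]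
  abel

/-- **Woodbury step.** If `B` is a bounded inverse of `T : p → E`, `F : E →L E` is bounded and `W` is a unit of `E →L E`
with `↑W = 1 − F ∘ B`, then `B ∘ W⁻¹` is a bounded inverse of `T − F|ₚ`. [cite: Kato1966, IV-§1.4, Thm. 1.16] -/
theorem HasBoundedInverse.sub_of_unit {p : Submodule 𝕜 E} {T : p →ₗ[𝕜] E} {B : E →L[𝕜] E}
    (h : HasBoundedInverse p T B) (F : E →L[𝕜] E) (W : (E →L[𝕜] E)ˣ)
    (hW : (W : E →L[𝕜] E) = 1 - F.comp B) :
    HasBoundedInverse p (T - (F : E →ₗ[𝕜] E).comp p.subtype) (B.comp (↑W⁻¹ : E →L[𝕜] E)) := by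
  have hWinv : ∀ f, (W : E →L[𝕜] E) ((↑W⁻¹ : E →L[𝕜] E) f) = f := fun f => by
    rw [← ContinuousLinearMap.comp_apply, ← ContinuousLinearMap.mul_def, Units.mul_inv]
    rfl
  have hinvW : ∀ f, (↑W⁻¹ : E →L[𝕜] E) ((W : E →L[𝕜] E) f) = f := fun f => by
    rw [← ContinuousLinearMap.comp_apply, ← ContinuousLinearMap.mul_def, Units.inv_mul]
    rfl
  have hWapp : ∀ g : E, (W : E →L[𝕜] E) g = g - F (B g) := fun g => by
    rw [hW]
    rfl
  refine ⟨fun f => h.mem _, fun f => ?_, fun u => ?_⟩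
  · -- right inverse
    have h1 : (T - (F : E →ₗ[𝕜] E).comp p.subtype) ⟨(B.comp (↑W⁻¹ : E →L[𝕜] E)) f, h.mem _⟩
        = T ⟨B ((↑W⁻¹ : E →L[𝕜] E) f), h.mem _⟩ - F (B ((↑W⁻¹ : E →L[𝕜] E) f)) := rfl
    rw [h1, h.right_inv, ← hWapp, hWinv]
  · -- left inverse
    have h1 : (T - (F : E →ₗ[𝕜] E).comp p.subtype) u = T u - F (u : E) := rfl
    have h2 : F (u : E) = F (B (T u)) := by rw [h.left_inv]
    rw [ContinuousLinearMap.comp_apply, h1, h2, ← hWapp, hinvW, h.left_inv]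

section Complete

variable [CompleteSpace E]

/-- Small-norm case (Neumann series): `‖F ∘ B‖ < 1` makes `1 − F B` a unit, so `T − F|ₚ` has the bounded inverse
`B (1 − F B)⁻¹`. [cite: Kato1966, IV-§1.4, Thm. 1.16] -/
theorem HasBoundedInverse.sub_of_norm_lt {p : Submodule 𝕜 E} {T : p →ₗ[𝕜] E} {B : E →L[𝕜] E}
    (h : HasBoundedInverse p T B) (F : E →L[𝕜] E) (hF : ‖F.comp B‖ < 1) :
    HasBoundedInverse p (T - (F : E →ₗ[𝕜] E).comp p.subtype)
      (B.comp (↑(Units.oneSub (F.comp B) hF)⁻¹ : E →L[𝕜] E)) :=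
  h.sub_of_unit F (Units.oneSub (F.comp B) hF) rfl

/-- Small-norm case with the norm bound: `‖(T − F|ₚ)⁻¹‖ ≤ ‖B‖ / (1 − ‖F ∘ B‖)`; in particular, with `‖B‖ ≤ M₀` and
`‖F‖ M₀ < 1`, `≤ M₀ / (1 − ‖F‖ M₀)`. [cite: Kato1966, IV-§1.4, Thm. 1.16] -/
theorem HasBoundedInverse.exists_sub_norm_le {p : Submodule 𝕜 E} {T : p →ₗ[𝕜] E} {B : E →L[𝕜] E}
    (h : HasBoundedInverse p T B) (F : E →L[𝕜] E) {M₀ : ℝ} (hB : ‖B‖ ≤ M₀) (hF : ‖F‖ * M₀ < 1) :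
    ∃ B' : E →L[𝕜] E, HasBoundedInverse p (T - (F : E →ₗ[𝕜] E).comp p.subtype) B' ∧
      ‖B'‖ ≤ M₀ / (1 - ‖F‖ * M₀) := by
  have hM₀ : 0 ≤ M₀ := (norm_nonneg _).trans hB
  have ht : ‖F.comp B‖ ≤ ‖F‖ * M₀ :=
    (ContinuousLinearMap.opNorm_comp_le _ _).trans (mul_le_mul_of_nonneg_left hB (norm_nonneg _))
  have ht1 : ‖F.comp B‖ < 1 := lt_of_le_of_lt ht hF
  refine ⟨_, h.sub_of_norm_lt F ht1, ?_⟩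
  have hpos : 0 < 1 - ‖F‖ * M₀ := by linarith
  have hpos' : 0 < 1 - ‖F.comp B‖ := by linarith
  calc ‖B.comp (↑(Units.oneSub (F.comp B) ht1)⁻¹ : E →L[𝕜] E)‖
      ≤ ‖B‖ / (1 - ‖F.comp B‖) := norm_comp_oneSub_inv_le B ht1
    _ ≤ M₀ / (1 - ‖F‖ * M₀) := by
        rw [div_le_div_iff₀ hpos' hpos]
        nlinarith [norm_nonneg B, norm_nonneg F]

end Complete

end Literature.Analysis.OperatorTheory
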